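import Literature.AlgebraicGeometry.Motives.AbelianVarietyFrobeniusTwistVariety
import Literature.AlgebraicGeometry.Motives.AbelianVarietyHomGenericDifferential
import Literature.AlgebraicGeometry.Motives.AbelianVarietyRationalMaps
import Literature.AlgebraicGeometry.Motives.AbelianVarietyRigidity
import Mathlib.AlgebraicGeometry.Birational.RationalMap
import HarnessLib

/-!
# Homomorphisms whose generic comorphism lands in `p`-th powers factor through the relative Frobenius
# (Shimura 1998, §2.8 Prop. 6 and §18.6 p. 129: «`π = ψ ∘ λ̃`»)

Topic `Literature/AlgebraicGeometry/Motives`, namespace `Literature.AlgebraicGeometry.Motives.AbelianVariety`.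
Theorems only (no definition, no named fact; net Literature debt 0).  Cell `hodgecm-mathlib` (D-0151),
fan A rung A-II (h21), EDITION E2 «height-one road» for the degree-one Shimura–Taniyama congruence,
pieces L3/L4 of A-p02's memo `ROAD-E2-heightOne-S2degOne.md` §5.

Let `A`, `B` be abelian varieties over a perfect field `K` of characteristic `p`, `f : A → B` a
homomorphism, `ξ` the generic point of `A`, `F = F_{A/K} : A → A^{(p)}` the relative Frobenius
(`AbelianVariety.relFrobenius p 1`).  Shimura §2.8 Prop. 6 (i): «`δλ = 0` iff `k(λx) ⊂ k(x^p)`», and then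
(p. 129) «`π = ψ ∘ λ̃`».  This file proves the factorisation half:

* `exists_stalkMap_relFrobenius_eq_pow` — the comorphism `F^♯_x : 𝒪_{A^{(p)},F x} → 𝒪_{A,x}` hits every
  `p`-th power (`F ≫ pr_A` is the absolute Frobenius `s ↦ s^p`).
* `toSchemeHom_relFrobenius_genericPoint`, `stalkMap_relFrobenius_genericPoint_injective` — over a
  perfect field `pr_A : A^{(p)} → A` is an isomorphism of schemes, so `F ξ` is the generic point of
  `A^{(p)}` and `F^♯_ξ : K(A^{(p)}) → K(A)` is injective (its image is `K(A)^p`).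
* `exists_eq_relFrobenius_comp_of_forall_exists_pow_eq` — **if every `f^♯_ξ b` (`b ∈ 𝒪_{B,f ξ}`) is a
  `p`-th power in `K(A)`, then `f = F_{A/K} ≫ g` for a homomorphism `g : A^{(p)} → B`.**  Construction:
  `θ = (F^♯_ξ)⁻¹ ∘ f^♯_ξ : 𝒪_{B,fξ} → 𝒪_{A^{(p)},Fξ}` gives a `K`-morphism `Spec 𝒪_{A^{(p)},Fξ} → B`,
  i.e. a rational map `A^{(p)} ⇢ B` (Mathlib `Scheme.PartialMap.ofFromSpecStalk`), which extends to a
  morphism by Milne's Thm. 3.1 (tree `existsUnique_extension`, Weil); it agrees with `f` after `F` at the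
  generic point, hence everywhere (`A` reduced, `B` separated), and preserves the origin, hence is a
  homomorphism (rigidity, `isMonHom_of_one_comp`).
* `exists_eq_relFrobenius_comp_of_forall_tangent_comp_eq_one` — **«`δλ = 0 ⇒ λ = ψ ∘ F_{A/K}`»**: combined
  with `AbelianVarietyHomGenericDifferential.exists_pow_eq_stalkMap_genericPoint` (Shimura §2.8 Thm. 1 /
  Prop. 6 (i)), a homomorphism killing the `K(A)`-valued tangent vectors at the origin factors through the
  relative Frobenius.

## References

* [Shimura1998] G. Shimura, *Abelian Varieties with Complex Multiplication and Modular Functions*,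
  Princeton 1998, §2.8 Prop. 6 (pp. 25–26); §18.6 proof of Thm. 18.6, p. 129.
* [Milne1986AbelianVarieties] J. S. Milne, *Abelian Varieties*, §3 Thm. 3.1 (rational maps to abelian
  varieties).
-/

universe u

open CategoryTheory AlgebraicGeometry Opposite
open scoped MonObj

noncomputable section

namespace Literature.AlgebraicGeometry.Motives

namespace AbelianVariety

variable {K : Type u} [Field K] {A B : AbelianVariety K}

/-! ### Stalk-level bookkeeping -/

/-- The power endomorphism `powEndo` acts on stalks by `t ↦ tⁿ`. [folklore] -/
private theorem powEndo_stalkMap_apply {X : Scheme.{u}} (n : ℕ) (hn : n ≠ 0)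
    (hadd : ∀ (U : X.Opens) (a b : Γ(X, U)), (a + b) ^ n = a ^ n + b ^ n) (x : X)
    (t : X.presheaf.stalk x) :
    (powEndo X n hn hadd).stalkMap x t = t ^ n := by
  obtain ⟨U, hxU, s, rfl⟩ := X.presheaf.exists_germ_eq t
  have h := Scheme.Hom.germ_stalkMap_apply (powEndo X n hn hadd) U x hxU s
  rw [powEndo_app_apply] at h
  exact h.trans (map_pow _ s n)

/-- `Spec 𝒪_{X,x} → X → Spec K` is `Spec` of the structure map `K → Γ(X, 𝒪_X) → 𝒪_{X,x}` for a
`K`-scheme `X`. [folklore] -/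
private theorem fromSpecStalk_comp_hom' (X : SchemeOver K) (x : X.left) :
    X.left.fromSpecStalk x ≫ X.hom =
      Spec.map (CommRingCat.ofHom ((X.left.presheaf.germ ⊤ x trivial).hom.comp
        (X.hom.appTop.hom.comp (Scheme.ΓSpecIso (.of K)).inv.hom))) := by
  rw [← Scheme.SpecMap_stalkMap_fromSpecStalk, Spec.fromSpecStalk_eq, ← Spec.map_comp,
    Category.assoc, Scheme.Hom.germ_stalkMap]
  rfl

/-- The structure maps `K → 𝒪` are compatible with the stalk maps of a `K`-morphism:
`h^♯_x ∘ (K → 𝒪_{Y,h x}) = (K → 𝒪_{X,x})`. [folklore] -/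
private theorem stalkMap_comp_structureMap {X Y : SchemeOver K} (h : X ⟶ Y) (x : X.left) :
    (h.left.stalkMap x).hom.comp ((Y.left.presheaf.germ ⊤ (h.left x) trivial).hom.comp
        (Y.hom.appTop.hom.comp (Scheme.ΓSpecIso (.of K)).inv.hom)) =
      (X.left.presheaf.germ ⊤ x trivial).hom.comp
        (X.hom.appTop.hom.comp (Scheme.ΓSpecIso (.of K)).inv.hom) := by
  have h1 : Y.left.presheaf.germ ⊤ (h.left x) trivial ≫ h.left.stalkMap x =
      h.left.appTop ≫ X.left.presheaf.germ ⊤ x trivial :=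
    Scheme.Hom.germ_stalkMap h.left ⊤ x trivial
  have h2 : Y.hom.appTop ≫ h.left.appTop = X.hom.appTop := by
    rw [← Scheme.Hom.comp_appTop, Over.w h]
  ext c
  change (Y.left.presheaf.germ ⊤ (h.left x) trivial ≫ h.left.stalkMap x).hom
      (Y.hom.appTop.hom ((Scheme.ΓSpecIso (.of K)).inv.hom c)) =
    (X.left.presheaf.germ ⊤ x trivial).hom (X.hom.appTop.hom ((Scheme.ΓSpecIso (.of K)).inv.hom c))
  rw [h1, ← h2]
  rfl

/-! ### The relative Frobenius at the generic point -/

variable (A) (p : ℕ) [Fact p.Prime] [ExpChar K p]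

omit [Fact p.Prime] in
/-- **`F^♯_x` hits every `p`-th power**: for the relative Frobenius `F = F_{A/K} : A → A^{(p)}` and a point
`x` of `A`, every `c^p` (`c ∈ 𝒪_{A,x}`) is in the image of `F^♯_x : 𝒪_{A^{(p)},F x} → 𝒪_{A,x}` — because
`F ≫ pr_A` is the absolute Frobenius, which is `t ↦ t^p` on stalks (Hartshorne IV Rem. 2.4.1; Milne, *Étale
cohomology* VI §13). [cite: Shimura1998, §2.8 Prop. 6 (i) (the subfield `k(x^p)`)] -/
theorem exists_stalkMap_relFrobenius_eq_pow (x : A.X.left) (c : A.X.left.presheaf.stalk x) :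
    ∃ c' : (A.frobeniusTwist p 1).X.left.presheaf.stalk (Hom.toSchemeHom (A.relFrobenius p 1) x),
      (Hom.toSchemeHom (A.relFrobenius p 1)).stalkMap x c' = c ^ p := by
  have hcomp : Hom.toSchemeHom (A.relFrobenius p 1) ≫ twistFst p 1 A.X = absFrobeniusOver p 1 A.X :=
    toSchemeHom_relFrobenius_comp_twistFst p 1 A
  -- `(F ≫ pr_A)^♯_x = e ≫ (F^abs)^♯_x` with `e` the identification of the stalks at `pr_A (F x)` and `x`
  obtain ⟨e, he⟩ : ∃ e : A.X.left.presheaf.stalk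
      ((Hom.toSchemeHom (A.relFrobenius p 1) ≫ twistFst p 1 A.X) x) ≅
        A.X.left.presheaf.stalk (absFrobeniusOver p 1 A.X x),
      (Hom.toSchemeHom (A.relFrobenius p 1) ≫ twistFst p 1 A.X).stalkMap x =
        e.hom ≫ (absFrobeniusOver p 1 A.X).stalkMap x :=
    ⟨_, Scheme.Hom.stalkMap_congr_hom _ _ hcomp x⟩
  refine ⟨(twistFst p 1 A.X).stalkMap (Hom.toSchemeHom (A.relFrobenius p 1) x) (e.inv c), ?_⟩
  have h1 : (Hom.toSchemeHom (A.relFrobenius p 1)).stalkMap x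
      ((twistFst p 1 A.X).stalkMap (Hom.toSchemeHom (A.relFrobenius p 1) x) (e.inv c)) =
      (Hom.toSchemeHom (A.relFrobenius p 1) ≫ twistFst p 1 A.X).stalkMap x (e.inv c) := by
    rw [Scheme.Hom.stalkMap_comp]; rfl
  have h2 : (Hom.toSchemeHom (A.relFrobenius p 1) ≫ twistFst p 1 A.X).stalkMap x (e.inv c) =
      (absFrobeniusOver p 1 A.X).stalkMap x (e.hom (e.inv c)) := by
    rw [he]; rfl
  have h3 : (absFrobeniusOver p 1 A.X).stalkMap x (e.hom (e.inv c)) =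
      (absFrobeniusOver p 1 A.X).stalkMap x c :=
    congrArg ((absFrobeniusOver p 1 A.X).stalkMap x) (e.inv_hom_id_apply c)
  rw [h1, h2, h3, powEndo_stalkMap_apply, pow_one]

variable [PerfectField K]

omit [Fact p.Prime] in
/-- Over a perfect field the projection `pr_A : A^{(p)} → A` is an isomorphism of schemes (base change of the
isomorphism `Spec Frob : Spec K → Spec K`). [folklore] -/
private theorem isIso_twistFst : IsIso (twistFst p 1 A.X) := by
  haveI : PerfectRing K p := PerfectField.toPerfectRing p
  haveI : IsIso (frobSpec K p 1) := by
    haveI : IsIso (CommRingCat.ofHom (iterateFrobenius K p 1)) := by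
      rw [iterateFrobenius_one]
      exact (RingEquiv.toCommRingCatIso (frobeniusEquiv K p)).isIso_hom
    show IsIso (Spec.map (CommRingCat.ofHom (iterateFrobenius K p 1)))
    infer_instance
  rw [twistFst_def]
  exact Limits.pullback_fst_iso_of_right_iso _ _

omit [Fact p.Prime] in
/-- **`F ξ` is the generic point of `A^{(p)}`** (`ξ` the generic point of `A`): `pr_A (F ξ) = ξ`,
`pr_A (ξ') = ξ` for the generic point `ξ'` of `A^{(p)}` (an isomorphism of schemes preserves generic points),
and `pr_A` is injective. [cite: Shimura1998, §2.8 Prop. 6 (i)] -/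
theorem toSchemeHom_relFrobenius_genericPoint :
    Hom.toSchemeHom (A.relFrobenius p 1) (genericPoint A.X.left) =
      genericPoint (A.frobeniusTwist p 1).X.left := by
  haveI := isIso_twistFst A p
  haveI : IrreducibleSpace (frobeniusTwistOver p 1 A.X).left :=
    (inferInstance : IrreducibleSpace (A.frobeniusTwist p 1).X.left)
  have h1 : twistFst p 1 A.X (Hom.toSchemeHom (A.relFrobenius p 1) (genericPoint A.X.left)) =
      genericPoint A.X.left := twistFst_relFrobenius_apply p 1 A _
  have h2 : twistFst p 1 A.X (genericPoint (A.frobeniusTwist p 1).X.left) = genericPoint A.X.left :=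
    genericPoint_eq_of_isOpenImmersion (twistFst p 1 A.X)
  exact (twistFst p 1 A.X).isOpenEmbedding.injective (h1.trans h2.symm)

omit [Fact p.Prime] in
/-- **`F^♯_ξ : 𝒪_{A^{(p)},F ξ} → K(A)` is injective** (its source is the function field of `A^{(p)}`, a
field). [cite: Shimura1998, §2.8 Prop. 6 (i)] -/
theorem stalkMap_relFrobenius_genericPoint_injective :
    Function.Injective ((Hom.toSchemeHom (A.relFrobenius p 1)).stalkMap (genericPoint A.X.left)) := by
  have hfield : IsField ((A.frobeniusTwist p 1).X.left.presheaf.stalk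
      (Hom.toSchemeHom (A.relFrobenius p 1) (genericPoint A.X.left))) :=
    ((A.frobeniusTwist p 1).X.left.presheaf.stalkCongr
      (.of_eq (toSchemeHom_relFrobenius_genericPoint A p))).commRingCatIsoToRingEquiv.toMulEquiv.isField
        (Field.toIsField _)
  rw [injective_iff_map_eq_zero]
  intro a ha
  by_contra hne
  obtain ⟨b, hb⟩ := hfield.mul_inv_cancel hne
  have h1 : (Hom.toSchemeHom (A.relFrobenius p 1)).stalkMap (genericPoint A.X.left) (a * b) = 1 := by
    rw [hb, map_one]
  rw [map_mul, ha, zero_mul] at h1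
  exact zero_ne_one h1

/-! ### Factoring through the relative Frobenius -/

variable {A}

omit [Fact p.Prime] in
/-- **Factorisation through the relative Frobenius** (Shimura §2.8 Prop. 6 and §18.6 p. 129, «`π = ψ ∘ λ̃`»):
let `f : A → B` be a homomorphism of abelian varieties over a perfect field `K` of characteristic `p` such
that every `f^♯_ξ b` (`b ∈ 𝒪_{B,f ξ}`, `ξ` the generic point of `A`) is a `p`-th power in `K(A) = 𝒪_{A,ξ}`.
Then `f = F_{A/K} ≫ g` for a homomorphism `g : A^{(p)} → B`.  Proof: `θ := (F^♯_ξ)⁻¹ ∘ f^♯_ξ` defines a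
`K`-morphism `Spec 𝒪_{A^{(p)},Fξ} → B`, i.e. a rational map `A^{(p)} ⇢ B`, which is a morphism `g` by
Milne's Thm. 3.1 (`existsUnique_extension`); `F ≫ g = f` at the generic point, hence everywhere; `g` fixes
the origin, hence is a homomorphism (`isMonHom_of_one_comp`). [cite: Shimura1998, §2.8 Prop. 6; §18.6 p. 129]
[cite: Milne1986AbelianVarieties, §3 Thm. 3.1] -/
theorem exists_eq_relFrobenius_comp_of_forall_exists_pow_eq (f : A ⟶ B)
    (hf : ∀ b : B.X.left.presheaf.stalk (Hom.toSchemeHom f (genericPoint A.X.left)),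
      ∃ c : A.X.left.presheaf.stalk (genericPoint A.X.left),
        c ^ p = (Hom.toSchemeHom f).stalkMap (genericPoint A.X.left) b) :
    ∃ g : A.frobeniusTwist p 1 ⟶ B, f = A.relFrobenius p 1 ≫ g := by
  have hFinj := stalkMap_relFrobenius_genericPoint_injective A p
  -- `θ : 𝒪_{B, f ξ} → 𝒪_{A^{(p)}, F ξ}` with `F^♯ ∘ θ = f^♯`
  have hrange : ∀ b : B.X.left.presheaf.stalk (Hom.toSchemeHom f (genericPoint A.X.left)),
      ∃ c', (Hom.toSchemeHom (A.relFrobenius p 1)).stalkMap (genericPoint A.X.left) c' =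
        (Hom.toSchemeHom f).stalkMap (genericPoint A.X.left) b := fun b => by
    obtain ⟨c, hc⟩ := hf b
    obtain ⟨c', hc'⟩ := exists_stalkMap_relFrobenius_eq_pow A p (genericPoint A.X.left) c
    exact ⟨c', hc'.trans hc⟩
  choose θf hθf using hrange
  let θ : B.X.left.presheaf.stalk (Hom.toSchemeHom f (genericPoint A.X.left)) →+*
      (A.frobeniusTwist p 1).X.left.presheaf.stalk
        (Hom.toSchemeHom (A.relFrobenius p 1) (genericPoint A.X.left)) :=
    { toFun := θf
      map_one' := hFinj (by rw [hθf, map_one, map_one])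
      map_mul' := fun a b => hFinj (by rw [hθf, map_mul, map_mul, hθf, hθf])
      map_zero' := hFinj (by rw [hθf, map_zero, map_zero])
      map_add' := fun a b => hFinj (by rw [hθf, map_add, map_add, hθf, hθf]) }
  have hθ' : CommRingCat.ofHom θ ≫
      (Hom.toSchemeHom (A.relFrobenius p 1)).stalkMap (genericPoint A.X.left) =
        (Hom.toSchemeHom f).stalkMap (genericPoint A.X.left) := by
    ext b; exact hθf b
  -- the `K`-morphism `g_η : Spec 𝒪_{A^{(p)}, F ξ} → B` and the rational map it defines
  have hgη : (Spec.map (CommRingCat.ofHom θ) ≫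
      B.X.left.fromSpecStalk (Hom.toSchemeHom f (genericPoint A.X.left))) ≫ B.X.hom =
      (A.frobeniusTwist p 1).X.left.fromSpecStalk
        (Hom.toSchemeHom (A.relFrobenius p 1) (genericPoint A.X.left)) ≫ (A.frobeniusTwist p 1).X.hom := by
    rw [Category.assoc, fromSpecStalk_comp_hom' B.X, fromSpecStalk_comp_hom' (A.frobeniusTwist p 1).X,
      ← Spec.map_comp]
    congr 1
    -- ring maps `K → 𝒪_{A^{(p)},Fξ}`: compare after the injective `F^♯_ξ`
    have hinj : Function.Injective (fun g : CommRingCat.of K ⟶ (A.frobeniusTwist p 1).X.left.presheaf.stalk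
          (Hom.toSchemeHom (A.relFrobenius p 1) (genericPoint A.X.left)) =>
        g ≫ (Hom.toSchemeHom (A.relFrobenius p 1)).stalkMap (genericPoint A.X.left)) :=
      fun g₁ g₂ hg => by
        ext c
        exact hFinj (by simpa using congrArg (fun g : CommRingCat.of K ⟶ _ => g.hom c) hg)
    apply hinj
    change (CommRingCat.ofHom _ ≫ CommRingCat.ofHom θ) ≫ _ = CommRingCat.ofHom _ ≫ _
    rw [Category.assoc, hθ']
    ext c
    change (((Hom.toSchemeHom f).stalkMap (genericPoint A.X.left)).hom.comp
        ((B.X.left.presheaf.germ ⊤ (Hom.toSchemeHom f (genericPoint A.X.left)) trivial).hom.comp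
          (B.X.hom.appTop.hom.comp (Scheme.ΓSpecIso (.of K)).inv.hom))) c =
      (((Hom.toSchemeHom (A.relFrobenius p 1)).stalkMap (genericPoint A.X.left)).hom.comp
        (((A.frobeniusTwist p 1).X.left.presheaf.germ ⊤
            (Hom.toSchemeHom (A.relFrobenius p 1) (genericPoint A.X.left)) trivial).hom.comp
          ((A.frobeniusTwist p 1).X.hom.appTop.hom.comp (Scheme.ΓSpecIso (.of K)).inv.hom))) c
    rw [stalkMap_comp_structureMap f.hom.hom.hom (genericPoint A.X.left),
      stalkMap_comp_structureMap (A.relFrobenius p 1).hom.hom.hom (genericPoint A.X.left)]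
  -- extension to a morphism (Milne Thm. 3.1)
  haveI := (A.frobeniusTwist p 1).smoothOfRelativeDimension_dim
  haveI : Smooth (A.frobeniusTwist p 1).X.hom :=
    SmoothOfRelativeDimension.smooth (A.frobeniusTwist p 1).dim _
  obtain ⟨g₀, hg₀, -⟩ := B.existsUnique_extension (X := (A.frobeniusTwist p 1).X)
    (Scheme.PartialMap.ofFromSpecStalk (A.frobeniusTwist p 1).X.hom B.X.hom _ hgη).domain
    ⟨_, Scheme.PartialMap.mem_domain_ofFromSpecStalk (A.frobeniusTwist p 1).X.hom B.X.hom _ hgη⟩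
    (Scheme.PartialMap.ofFromSpecStalk (A.frobeniusTwist p 1).X.hom B.X.hom _ hgη).hom
    (Scheme.PartialMap.ofFromSpecStalk_comp (A.frobeniusTwist p 1).X.hom B.X.hom _ hgη)
  -- `F ≫ g₀ = f`: first at the generic point of `A` ...
  have hgen : A.X.left.fromSpecStalk (genericPoint A.X.left) ≫
      (Hom.toSchemeHom (A.relFrobenius p 1) ≫ g₀.left) =
      A.X.left.fromSpecStalk (genericPoint A.X.left) ≫ Hom.toSchemeHom f := by
    rw [← Scheme.SpecMap_stalkMap_fromSpecStalk_assoc,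
      ← (Scheme.PartialMap.ofFromSpecStalk (A.frobeniusTwist p 1).X.hom B.X.hom _
        hgη).domain.fromSpecStalkOfMem_ι _
        (Scheme.PartialMap.mem_domain_ofFromSpecStalk (A.frobeniusTwist p 1).X.hom B.X.hom _ hgη),
      Category.assoc, hg₀]
    change Spec.map _ ≫ (Scheme.PartialMap.ofFromSpecStalk (A.frobeniusTwist p 1).X.hom B.X.hom _
      hgη).fromSpecStalkOfMem _ = _
    rw [Scheme.PartialMap.fromSpecStalkOfMem_ofFromSpecStalk, ← Spec.map_comp_assoc, hθ',
      Scheme.SpecMap_stalkMap_fromSpecStalk]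
  -- ... hence everywhere (`A` integral, `B` separated over `K`)
  haveI : (Hom.toSchemeHom (A.relFrobenius p 1) ≫ g₀.left).IsOver (Spec (.of K)) := ⟨by
    rw [Category.assoc]
    change Hom.toSchemeHom (A.relFrobenius p 1) ≫ g₀.left ≫ B.X.hom = A.X.hom
    rw [Over.w g₀]
    exact Over.w (A.relFrobenius p 1).hom.hom.hom⟩
  haveI : (Hom.toSchemeHom f).IsOver (Spec (.of K)) := ⟨Over.w f.hom.hom.hom⟩
  have heq : Hom.toSchemeHom (A.relFrobenius p 1) ≫ g₀.left = Hom.toSchemeHom f := by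
    have hequiv : (Hom.toSchemeHom (A.relFrobenius p 1) ≫ g₀.left).toPartialMap.equiv
        (Hom.toSchemeHom f).toPartialMap :=
      Scheme.PartialMap.equiv_of_fromSpecStalkOfMem_eq (x := genericPoint A.X.left) _ _ trivial trivial
        (by rw [Scheme.PartialMap.fromSpecStalkOfMem_toPartialMap,
          Scheme.PartialMap.fromSpecStalkOfMem_toPartialMap, hgen])
    have h := (Scheme.PartialMap.equiv_toPartialMap_iff_of_isSeparated (S := Spec (.of K))).mp hequiv
    change A.X.left.topIso.hom ≫ _ = A.X.left.topIso.hom ≫ _ at h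
    exact (cancel_epi _).mp h
  -- `g₀` preserves the origin, hence is a homomorphism
  have hFg₀ : (A.relFrobenius p 1).hom.hom.hom ≫ g₀ = f.hom.hom.hom :=
    Over.OverMorphism.ext heq
  have hone : η[(A.frobeniusTwist p 1).X] ≫ g₀ = η[B.X] := by
    rw [← IsMonHom.one_hom (A.relFrobenius p 1).hom.hom.hom, Category.assoc, hFg₀]
    exact IsMonHom.one_hom _
  haveI : IsMonHom g₀ := isMonHom_of_one_comp g₀ hone
  refine ⟨InducedCategory.homMk (Grp.homMk (A := (A.frobeniusTwist p 1).toGrp) (B := B.toGrp) g₀), ?_⟩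
  apply hom_ext
  exact hFg₀.symm

/-- **«`δλ = 0 ⇒ λ = ψ ∘ F_{A/K}`»** (Shimura §2.8 Prop. 6 with §18.6 p. 129): a homomorphism `f : A → B` of
abelian varieties over a perfect field of characteristic `p` whose tangent map vanishes on the `K(A)`-valued
tangent vectors at the origin (the `K(A)[ε]`-points at `e`) factors through the relative Frobenius:
`f = F_{A/K} ≫ g`.  (`exists_pow_eq_stalkMap_genericPoint`: `f^♯_ξ` lands in `K(A)^p`; then
`exists_eq_relFrobenius_comp_of_forall_exists_pow_eq`.)  The `K`-algebra structure on `K(A)` is the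
canonical one of a `K`-scheme (`RatFn.algebraStalk`). [cite: Shimura1998, §2.8 Prop. 6; §18.6 p. 129] -/
theorem exists_eq_relFrobenius_comp_of_forall_tangent_comp_eq_one (f : A ⟶ B)
    (hf : ∀ t : specOver K (DualNumber A.X.left.functionField) ⟶ A.X,
      AlgPoints.specOverMapOfAlgHom
          (TrivSqZeroExt.fstHom K A.X.left.functionField A.X.left.functionField) ≫ t = 1 →
        t ≫ f.hom.hom.hom = 1) :
    ∃ g : A.frobeniusTwist p 1 ⟶ B, f = A.relFrobenius p 1 ≫ g := by
  haveI : CharP K p := by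
    cases ‹ExpChar K p› with
    | zero => exact absurd (Fact.out : Nat.Prime 1) Nat.not_prime_one
    | prime hp => infer_instance
  exact exists_eq_relFrobenius_comp_of_forall_exists_pow_eq p f
    (exists_pow_eq_stalkMap_genericPoint p rfl f hf)

end AbelianVariety

end Literature.AlgebraicGeometry.Motives

end
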